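import Mathlib
import HarnessLib
import Summits.NavierStokesRegularity.NavierStokesRegularity.Theorems.UnthreadedDoorAntidynamoReflectionParity

/-!
# Route `UnthreadedDoor` / `ThreadingFlux`, crux `PoloidalLiouville` (stmt-NavierStokesRegularity-1222), antidynamo v2 skeleton
# (sha16 `4ebf5683127b`): THE WALL `stub_scalarLiouville` ON THE ODD SECTOR

Support file (seat leafhand-ns-unthreadeddoor-1 g1, cell decomp-ns), `--supports stmt-NavierStokesRegularity-1222 --as helper`; theorems only.

`stubScalarLiouville_of_odd_potential` — the registered wall `StubScalarLiouville` (scalar Liouville for the toroidal potential `T` of an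
unthreaded bounded ancient mild solution, `curl v = ∇T × (x − x₀)`) HOLDS ON THE ODD SECTOR: if the potential is odd under the point
reflection about the centre, `T(t, x₀ + x₀ − x) = −T(t, x)`, then `∇T × (x − x₀) ≡ 0`.  (Odd `T` ⇒ even `∇T` ⇒ odd vorticity ⇒ the
point-reflection Liouville theorem `constant_of_curl_reflect_odd` ⇒ constant slices ⇒ zero curl.)  Only the hypotheses of the wall that
are used are kept (class, measurability, joint smoothness, the representation); the evolution law (E1), the bound and the smoothness of
`T` are not needed on this sector.

HONEST LABEL: the odd sector only.  The wall for general (in particular even, e.g. zonal = axisymmetric) potentials stays OPEN in print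
beyond KNSS 2009 Thm 5.2; nothing here proves `stub_scalarLiouville`, `PoloidalLiouville` (1222), or bears on Navier–Stokes regularity;
no summit statement is proved. [folklore]
-/

noncomputable section

-- the summit and its single sub-problem share the name (CONVENTIONS §1)
set_option linter.dupNamespace false

open scoped Topology InnerProductSpace RealInnerProductSpace ContDiff
open Filter Set Function Metric MeasureTheory
open Literature.Analysis.FluidPDE

namespace Summit.NavierStokesRegularity.NavierStokesRegularity.Theorems.PoloidalLiouville.Antidynamo

/-- The gradient of a function that is ODD under `w ↦ c − w` is EVEN under it (junk values included: `D(f(c − ·)) = −Df(c − ·)` holds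
unconditionally). [folklore] -/
theorem gradient_reflect_of_odd {T : EuclideanSpace ℝ (Fin 3) → ℝ} (c : EuclideanSpace ℝ (Fin 3))
    (hodd : ∀ x, T (c - x) = -T x) (x : EuclideanSpace ℝ (Fin 3)) :
    gradient T (c - x) = gradient T x := by
  have hfun : (fun w => T (c - w)) = -T := by
    funext w; rw [Pi.neg_apply]; exact hodd w
  have h := fderiv_comp_const_sub T c x
  rw [hfun, fderiv_neg] at h
  have h2 : fderiv ℝ T (c - x) = fderiv ℝ T x := (neg_injective h).symm
  rw [gradient, gradient, h2]

/-- ★ **THE WALL ON THE ODD SECTOR.**  Let `v` be a bounded ancient mild solution (`ν = 1`, duality class) with measurable slices, jointly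
smooth on `(−∞,0) × ℝ³`, whose vorticity is represented by a toroidal potential, `curl (v t) x = ∇T(t, x) × (x − x₀)`, with `T(t, ·)` ODD
under the point reflection about `x₀` for every `t < 0`.  Then `∇T(t, x) × (x − x₀) = 0` for all `t < 0`, `x` — the conclusion of the
registered wall `StubScalarLiouville`, on this sector and without its remaining hypotheses. [folklore] -/
theorem stubScalarLiouville_of_odd_potential
    (v : ℝ → EuclideanSpace ℝ (Fin 3) → EuclideanSpace ℝ (Fin 3)) (x₀ : EuclideanSpace ℝ (Fin 3))
    (T : ℝ → EuclideanSpace ℝ (Fin 3) → ℝ)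
    (hB : Literature.Analysis.FluidPDE.IsBoundedAncientMildSolution 1 v)
    (hm : ∀ t < 0, AEStronglyMeasurable (v t) volume)
    (hsm : ContDiffOn ℝ (⊤ : ℕ∞) (Function.uncurry v) (Set.Iio 0 ×ˢ Set.univ))
    (hrep : ∀ t < 0, ∀ x, Literature.Analysis.FluidPDE.curl (v t) x =
      Literature.Analysis.FluidPDE.cross (gradient (T t) x) (x - x₀))
    (hTodd : ∀ t < 0, ∀ x, T t (x₀ + x₀ - x) = -T t x) :
    ∀ t < 0, ∀ x, Literature.Analysis.FluidPDE.cross (gradient (T t) x) (x - x₀) = 0 := by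
  -- the vorticity is odd about `x₀`
  have hodd : ∀ t < 0, ∀ x, curl (v t) (x₀ + x₀ - x) = -curl (v t) x := by
    intro t ht x
    rw [hrep t ht, hrep t ht, gradient_reflect_of_odd (x₀ + x₀) (hTodd t ht) x]
    have e1 : x₀ + x₀ - x - x₀ = -(x - x₀) := by abel
    rw [e1, ← crossCLM_apply, ← crossCLM_apply, map_neg]
  -- hence the slices are constant, hence irrotational
  have hconst := constant_of_curl_reflect_odd v (x₀ + x₀) hB hm hsm hodd
  intro t ht x
  obtain ⟨b, hb⟩ := hconst t ht
  have hvt : v t = fun _ => b := funext hb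
  rw [← hrep t ht x, curl_eq_curlCLM, hvt, fderiv_fun_const]
  exact map_zero _

end Summit.NavierStokesRegularity.NavierStokesRegularity.Theorems.PoloidalLiouville.Antidynamo

end
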